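import Literature.MathematicalPhysics.QuantumLattice.InfVolFermionStateTorusLimitEnergyEntropyBalance
import Literature.MathematicalPhysics.QuantumLattice.TorusSectorGibbsMixtureChargeRows
import HarnessLib

/-!
# `t–t'` Hubbard model at `T > 0`: the THERMAL window certificate (state relaxation with
# energy–entropy-balance rows) read in an abstract state and in every thermal torus-limit state

Topic `Literature/MathematicalPhysics/QuantumLattice`; the positive-temperature companion of
`HubbardTTPrimeWindowCertificateAbstractState.lean`. A certified two-sided window for a thermal
expectation value `ω(X)` — `ω` a `β`-KMS (here: thermal torus-limit) state of the `t–t'–U` Hubbard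
model — is obtained from a relaxation over functionals `ω̃` on a window algebra `𝔄_{Λ'}` that are
positive (`ω̃(O⋆O) ≥ 0`), normalised, stationary (`ω̃(H_{Λ'}ΓB − ΓB H_{Λ'}) = 0`), symmetric
(translation defects vanish), kill charged words, and satisfy the LINEARISED ENERGY–ENTROPY BALANCE
rows `0 ≤ Re ω̃(β·(ΓA)ᴴ(H_{Λ'}ΓA − ΓA H_{Λ'}) − s·(ΓA)ᴴΓA + q·ΓA(ΓA)ᴴ)` (`e^{s−1} ≤ q`, `A` gauge
invariant) — Fawzi–Fawzi–Scalet's relaxation (opt2) with the scalar EEB constraint linearised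
(`GibbsEnergyEntropyBalance.lean`), i.e. an ordinary semidefinite program whose rounded dual is an
operator IDENTITY in `𝔄_{Λ'}`:

  `Xw − c·1 − Σ_σ μ_σ (n_{0σ} − ν·1) − κ (u·1 − Γ E^{tt'}_Φ)
     = Σ Λₐᵦ Oₐᴴ O_b                                              (Gram / SOS part, Λ ⪰ 0)
     + (Σₖ (H_{Λ'} ΓBₖ − ΓBₖ H_{Λ'}) + Σₗ (Γ(γₗΛ + wₗ ← Λ)Yₗ − ΓYₗ) + Σⱼ bⱼ Wⱼ)   (null rows)
     + (Σᵣ λᵣ · EEB_{β,sᵣ,qᵣ}(Aᵣ) + Σₑ κₑ · Gₑ)                   (NONNEGATIVE rows, λᵣ, κₑ ≥ 0)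
     + (Σₘ dₘ (Vₘᴴ − Vₘ) + Σₖ aₖ Wₖ)`                            (anti-Hermitian parts, residual words).

* §1 `le_re_map_of_certificate_rows` — the abstract weak-duality lemma with nonnegative rows:
  `h − c·1 = gram + n + g + r`, `ω(n) = 0`, `Re ω(g) ≥ 0`, `Re ω(r) ≥ −ε` ⇒ `c − ε ≤ Re ω(h)`
  (`StateRelaxation.le_re_map_of_certificate_residual` plus one inequality).
* §2 `InfVolFermionState.re_expect_ge_of_thermal_certificate_TT'_of_rows` — **the thermal certificate
  read in an ABSTRACT infinite-volume state** `ω`: if `ω` kills the eom rows, the symmetry defects and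
  the charged words of the certificate, and is nonnegative on its EEB rows and on its extra rows `Gₑ`,
  then `c − Σₖ‖aₖ‖ + Σ_σ μ_σ (Re ω(n_{0σ}) − ν) + κ (u − e^{tt'}(ω)) ≤ Re ω_{Λ'}(Xw)`. Every state
  property is an explicit hypothesis; no temperature enters except through the row data `β`.
* §3 `InfVolFermionState.IsTorusLimitOfMixture.re_expect_ge_of_thermal_certificate_TT'_of_sectorGibbs`
  — **the thermal certificate bounds every thermal torus-limit state**: for `ω` a torus limit of the
  canonical Gibbs states of `hubbardTorusTT' L t t' U` at inverse temperature `β` on the sectors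
  `(rectN n L, S^z = 0)` (`TorusSectorGibbsMixture`), a TRANSLATION-reduced certificate (`γₗ = 1`,
  `thicken Λ 1 ⊆ Λ'`) whose EEB generators `Aᵣ` conserve the local `N` and `S^z` and whose slopes
  satisfy `e^{sᵣ−1} ≤ qᵣ`, `λᵣ ≥ 0`, proves the same inequality with the eom rows, the translation
  defects, the charged words and the EEB rows DISCHARGED
  (`InfVolFermionStateTorusLimitEnergyEntropyBalance.lean`, `TorusSectorGibbsMixtureChargeRows.lean`,
  `IsTorusLimitOfMixture.isTranslationInvariant`); only the extra rows `Gₑ` stay hypotheses (e.g. the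
  CUT/CAP energy rows of `TorusSectorGibbsMixture`, supplied by the caller by name).
* §4 the **certified thermal energy window**: `Re ω_{Λ'}(Γ E^{tt'}_Φ) = e^{tt'}(ω)`
  (`re_expect_fermionEmbed_meanEnergyObs`), so a certificate with objective `Xw = −Γ E^{tt'}_Φ`
  (`μ = 0`, `κ = 0`) is a certified UPPER bound `e^{tt'}(ω) ≤ Σₖ‖aₖ‖ − c` on the thermal energy per
  site of every such torus limit (`…meanEnergy_le_of_thermal_certificate_TT'_of_sectorGibbs`), to be
  paired with the variational lower bound `energyDensityTT' t t' U n ≤ e^{tt'}(ω)`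
  (`IsTorusLimitOfMixture.energyDensityTT'_le_meanEnergy_of_sectorGibbs`): the two-sided thermal
  energy window `…meanEnergy_mem_Icc_of_thermal_certificate_TT'_of_sectorGibbs`.

Sources: H. Fawzi, O. Fawzi, S. O. Scalet (2024) §3.2 (opt1)/(opt2), Thm. 3.6 (certified upper and
lower bounds on thermal expectation values from EEB-constrained relaxations) [FawziFawziScalet2024];
J. Wang et al., PRX 14 (2024) 031006 §III (constrained relaxations bound every feasible state)
[WangEtAl2024]; I. Kull et al., PRX 14 (2024) 021008 §5.3 (rounded dual certificates with residual)
[KullEtAl2024]. Everything is PROVED; no definition, no named fact.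
-/

noncomputable section

namespace Literature.MathematicalPhysics.QuantumLattice

open Matrix Finset HubbardWave0 Literature.Probability.LatticeModels ThermodynamicLimit
open Literature.MathematicalPhysics.QuantumManyBody.StateRelaxation
open _root_.Filter
open scoped _root_.Topology ComplexOrder BigOperators

/-! ### §1 Weak duality with nonnegative rows -/

section Abstract

variable {𝓐 : Type*} [Ring 𝓐] [StarRing 𝓐] [Algebra ℂ 𝓐] [StarModule ℂ 𝓐]
variable {m : Type*} [Fintype m] [DecidableEq m]

/-- **Certificate lemma with null rows, NONNEGATIVE rows and a residual.** If `ω` is positive and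
normalised, `h − c·1 = Σ Λₐᵦ Oₐ⋆O_b + n + g + r` with `Λ ⪰ 0`, `ω(n) = 0`, `0 ≤ Re ω(g)` (e.g. `g` a
nonnegative combination of energy–entropy-balance rows of a thermal state) and `−ε ≤ Re ω(r)`, then
`c − ε ≤ Re ω(h)`. [cite: KullEtAl2024, §5.3] -/
theorem le_re_map_of_certificate_rows (ω : 𝓐 →ₗ[ℂ] ℂ) (hpos : ∀ a, 0 ≤ ω (star a * a))
    (hone : ω 1 = 1) {Λ : Matrix m m ℂ} (hΛ : Λ.PosSemidef) (O : m → 𝓐) {h n g r : 𝓐}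
    (hn : ω n = 0) (hg : 0 ≤ (ω g).re) {ε : ℝ} (hr : -ε ≤ (ω r).re) {c : ℝ}
    (hcert : h - (c : ℂ) • (1 : 𝓐) = gramForm Λ O + n + g + r) : c - ε ≤ (ω h).re := by
  have hcert' : h - (c : ℂ) • (1 : 𝓐) = gramForm Λ O + n + (g + r) := by rw [hcert, add_assoc]
  have hr' : -ε ≤ (ω (g + r)).re := by
    rw [map_add, Complex.add_re]
    linarith
  exact le_re_map_of_certificate_residual ω hpos hone hΛ O hn hr' hcert'

end Abstract

/-! ### §2 The thermal certificate in an abstract state -/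

namespace InfVolFermionState

/-- `Re ω_{Λ'}(Γ E^{R}_Ψ) = e_Ψ(ω)`: the embedded mean-energy observable evaluates to the mean energy
(compatibility of `ω` with the inclusion `thicken {0} R ⊆ Λ'`). [cite: BratteliKishimotoRobinson1978, Thm. 2] -/
theorem re_expect_fermionEmbed_meanEnergyObs {d : ℕ} (ω : InfVolFermionState d) (Ψ : FermionInteraction d)
    (R : ℝ) {Λ' : Finset (Site d)} (h0 : thicken ({0} : Finset (Site d)) R ⊆ Λ') :
    (ω.expect Λ' (fermionEmbed (PolySite.incl h0) (Ψ.meanEnergyObs R))).re = ω.meanEnergy Ψ R := by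
  rw [ω.compatible h0, InfVolFermionState.meanEnergy]

/-- **The `t–t'` THERMAL window certificate read in an ABSTRACT infinite-volume state.** Let the
identity displayed in the module docstring hold in `𝔄_{Λ'}` (objective `Xw`, density multipliers
`μ_σ` at the origin, energy term `κ (u·1 − Γ E^{tt'}_Φ)`, Gram part with `Λm ⪰ 0`, eom rows
`H^{tt'}_{Λ'} ΓBₖ − ΓBₖ H^{tt'}_{Λ'}`, defects `Γ(d4Emb γₗ wₗ) Yₗ − Γ Yₗ`, charged words `bⱼ Wⱼ`,
energy–entropy-balance rows `λᵣ · (β·(ΓAᵣ)ᴴ(H_{Λ'}ΓAᵣ − ΓAᵣH_{Λ'}) − sᵣ·(ΓAᵣ)ᴴΓAᵣ + qᵣ·ΓAᵣ(ΓAᵣ)ᴴ)`,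
extra rows `κₑ · Gₑ`, anti-Hermitian parts `dₘ(Vₘᴴ − Vₘ)`, residual words `aₖ Wₖ`). If a state `ω` of
the lattice fermions on `ℤ²` kills the eom rows, the defects and the charged words, and satisfies
`0 ≤ Re ω_{Λ'}(EEBᵣ)` (`λᵣ ≥ 0`) and `0 ≤ Re ω_{Λ'}(Gₑ)` (`κₑ ≥ 0`), then
`c − Σₖ ‖aₖ‖ + Σ_σ μ_σ (Re ω_{Λ'}(n_{0σ}) − ν) + κ (u − e^{tt'}(ω)) ≤ Re ω_{Λ'}(Xw)`,
`e^{tt'}(ω) = ω.meanEnergy (hubbardTTPrimeFermionInteraction t t' U) 1`. Fawzi–Fawzi–Scalet 2024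
§3.2 (opt1)/(opt2) (every KMS state is feasible, so the relaxation value bounds its expectations),
read through the dual. [cite: FawziFawziScalet2024, Thm. 3.6] -/
theorem re_expect_ge_of_thermal_certificate_TT'_of_rows (ω : InfVolFermionState 2) (t t' U β : ℝ)
    {Λ Λ' : Finset (Site 2)} (hΛ : Λ ⊆ Λ')
    (h0 : thicken ({0} : Finset (Site 2)) 1 ⊆ Λ') (hz : (0 : Site 2) ∈ Λ')
    (Xw : FermionOp Λ') (κ u : ℝ) (μ : Fin 2 → ℝ) (ν : ℝ)
    {m : Type*} [Fintype m] [DecidableEq m] {Λm : Matrix m m ℂ} (hΛm : Λm.PosSemidef)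
    (O : m → FermionOp Λ')
    {κ' : Type*} (s : Finset κ') (B : κ' → FermionOp Λ)
    {ι : Type*} (tt : Finset ι) (γ : ι → DihedralGroup 4) (wv : ι → Site 2)
    (hsh : ∀ l, d4ShiftSet (γ l) (wv l) Λ ⊆ Λ') (Y : ι → FermionOp Λ)
    {ρ : Type*} (uu : Finset ρ) (b : ρ → ℂ) (cw : ρ → List (Orb (PolySite Λ') × Bool))
    {θ : Type*} (rr : Finset θ) (lam : θ → ℝ) (A : θ → FermionOp Λ) (sv qv : θ → ℝ)
    {η : Type*} (gg : Finset η) (kap : η → ℝ) (G : η → FermionOp Λ')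
    {δ : Type*} (ah : Finset δ) (dc : δ → ℝ) (V : δ → FermionOp Λ')
    {κ'' : Type*} (w : Finset κ'') (a : κ'' → ℂ) (word : κ'' → List (Orb (PolySite Λ') × Bool)) {c : ℝ}
    (hcert : Xw - (c : ℂ) • (1 : FermionOp Λ') -
        ∑ σ : Fin 2, ((μ σ : ℝ) : ℂ) • (nAt 0 hz σ - ((ν : ℝ) : ℂ) • (1 : FermionOp Λ')) -
        ((κ : ℝ) : ℂ) • (((u : ℝ) : ℂ) • (1 : FermionOp Λ') -
          fermionEmbed (PolySite.incl h0) ((hubbardTTPrimeFermionInteraction t t' U).meanEnergyObs 1)) =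
      gramForm Λm O +
        (∑ k ∈ s, ((hubbardTTPrimeFermionInteraction t t' U).localHamiltonian Λ' * fermionEmbed (PolySite.incl hΛ) (B k) -
            fermionEmbed (PolySite.incl hΛ) (B k) * (hubbardTTPrimeFermionInteraction t t' U).localHamiltonian Λ') +
          ∑ l ∈ tt, (fermionEmbed (PolySite.incl (hsh l)) (fermionEmbed (PolySite.d4Emb (γ l) (wv l) Λ) (Y l)) -
            fermionEmbed (PolySite.incl hΛ) (Y l)) +
          ∑ j ∈ uu, b j • ladderWord (cw j)) +
        (∑ r ∈ rr, ((lam r : ℝ) : ℂ) •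
            (((β : ℝ) : ℂ) • ((fermionEmbed (PolySite.incl hΛ) (A r))ᴴ *
                ((hubbardTTPrimeFermionInteraction t t' U).localHamiltonian Λ' * fermionEmbed (PolySite.incl hΛ) (A r) -
                  fermionEmbed (PolySite.incl hΛ) (A r) * (hubbardTTPrimeFermionInteraction t t' U).localHamiltonian Λ')) -
              ((sv r : ℝ) : ℂ) • ((fermionEmbed (PolySite.incl hΛ) (A r))ᴴ * fermionEmbed (PolySite.incl hΛ) (A r)) +
              ((qv r : ℝ) : ℂ) • (fermionEmbed (PolySite.incl hΛ) (A r) * (fermionEmbed (PolySite.incl hΛ) (A r))ᴴ)) +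
          ∑ e ∈ gg, ((kap e : ℝ) : ℂ) • G e) +
        (∑ m' ∈ ah, ((dc m' : ℝ) : ℂ) • ((V m')ᴴ - V m') + ∑ k ∈ w, a k • ladderWord (word k)))
    (heom : ∀ k ∈ s, ω.expect Λ'
        ((hubbardTTPrimeFermionInteraction t t' U).localHamiltonian Λ' * fermionEmbed (PolySite.incl hΛ) (B k) -
          fermionEmbed (PolySite.incl hΛ) (B k) * (hubbardTTPrimeFermionInteraction t t' U).localHamiltonian Λ') = 0)
    (hsym : ∀ l ∈ tt, ω.expect Λ'
        (fermionEmbed (PolySite.incl (hsh l)) (fermionEmbed (PolySite.d4Emb (γ l) (wv l) Λ) (Y l)) -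
          fermionEmbed (PolySite.incl hΛ) (Y l)) = 0)
    (hch : ∀ j ∈ uu, ω.expect Λ' (ladderWord (cw j)) = 0)
    (hlam : ∀ r ∈ rr, 0 ≤ lam r)
    (heeb : ∀ r ∈ rr, 0 ≤ (ω.expect Λ'
        (((β : ℝ) : ℂ) • ((fermionEmbed (PolySite.incl hΛ) (A r))ᴴ *
            ((hubbardTTPrimeFermionInteraction t t' U).localHamiltonian Λ' * fermionEmbed (PolySite.incl hΛ) (A r) -
              fermionEmbed (PolySite.incl hΛ) (A r) * (hubbardTTPrimeFermionInteraction t t' U).localHamiltonian Λ')) -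
          ((sv r : ℝ) : ℂ) • ((fermionEmbed (PolySite.incl hΛ) (A r))ᴴ * fermionEmbed (PolySite.incl hΛ) (A r)) +
          ((qv r : ℝ) : ℂ) • (fermionEmbed (PolySite.incl hΛ) (A r) * (fermionEmbed (PolySite.incl hΛ) (A r))ᴴ))).re)
    (hkap : ∀ e ∈ gg, 0 ≤ kap e) (hG : ∀ e ∈ gg, 0 ≤ (ω.expect Λ' (G e)).re) :
    c - ∑ k ∈ w, ‖a k‖ + ∑ σ : Fin 2, μ σ * ((ω.expect Λ' (nAt 0 hz σ)).re - ν) +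
        κ * (u - ω.meanEnergy (hubbardTTPrimeFermionInteraction t t' U) 1) ≤
      (ω.expect Λ' Xw).re := by
  -- the positive functional `ω_{Λ'}`
  have hpos : ∀ A' : FermionOp Λ', 0 ≤ ω.expect Λ' (star A' * A') := fun A' => by
    rw [Matrix.star_eq_conjTranspose]
    exact ω.expect_nonneg Λ' A'
  -- the null rows
  have hn : ω.expect Λ'
      (∑ k ∈ s, ((hubbardTTPrimeFermionInteraction t t' U).localHamiltonian Λ' * fermionEmbed (PolySite.incl hΛ) (B k) -
          fermionEmbed (PolySite.incl hΛ) (B k) * (hubbardTTPrimeFermionInteraction t t' U).localHamiltonian Λ') +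
        ∑ l ∈ tt, (fermionEmbed (PolySite.incl (hsh l)) (fermionEmbed (PolySite.d4Emb (γ l) (wv l) Λ) (Y l)) -
          fermionEmbed (PolySite.incl hΛ) (Y l)) +
        ∑ j ∈ uu, b j • ladderWord (cw j)) = 0 := by
    rw [map_add, map_add, map_sum, map_sum, map_sum, Finset.sum_eq_zero heom, Finset.sum_eq_zero hsym,
      Finset.sum_eq_zero (fun j hj => by rw [map_smul, hch j hj, smul_zero]), add_zero, add_zero]
  -- the nonnegative rows
  have hg : 0 ≤ (ω.expect Λ'
      (∑ r ∈ rr, ((lam r : ℝ) : ℂ) •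
          (((β : ℝ) : ℂ) • ((fermionEmbed (PolySite.incl hΛ) (A r))ᴴ *
              ((hubbardTTPrimeFermionInteraction t t' U).localHamiltonian Λ' * fermionEmbed (PolySite.incl hΛ) (A r) -
                fermionEmbed (PolySite.incl hΛ) (A r) * (hubbardTTPrimeFermionInteraction t t' U).localHamiltonian Λ')) -
            ((sv r : ℝ) : ℂ) • ((fermionEmbed (PolySite.incl hΛ) (A r))ᴴ * fermionEmbed (PolySite.incl hΛ) (A r)) +
            ((qv r : ℝ) : ℂ) • (fermionEmbed (PolySite.incl hΛ) (A r) * (fermionEmbed (PolySite.incl hΛ) (A r))ᴴ)) +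
        ∑ e ∈ gg, ((kap e : ℝ) : ℂ) • G e)).re := by
    rw [map_add, Complex.add_re, map_sum, map_sum, Complex.re_sum, Complex.re_sum]
    refine add_nonneg (Finset.sum_nonneg fun r hr => ?_) (Finset.sum_nonneg fun e he => ?_)
    · rw [map_smul, smul_eq_mul, Complex.re_ofReal_mul]
      exact mul_nonneg (hlam r hr) (heeb r hr)
    · rw [map_smul, smul_eq_mul, Complex.re_ofReal_mul]
      exact mul_nonneg (hkap e he) (hG e he)
  -- the residual
  have hah : (ω.expect Λ' (∑ m' ∈ ah, ((dc m' : ℝ) : ℂ) • ((V m')ᴴ - V m'))).re = 0 := by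
    rw [map_sum, Complex.re_sum]
    refine Finset.sum_eq_zero fun m' _ => ?_
    rw [map_smul, smul_eq_mul]
    exact ω.re_ofReal_mul_expect_conjTranspose_sub_self Λ' (dc m') (V m')
  have hr : -(∑ k ∈ w, ‖a k‖) ≤ (ω.expect Λ'
      (∑ m' ∈ ah, ((dc m' : ℝ) : ℂ) • ((V m')ᴴ - V m') + ∑ k ∈ w, a k • ladderWord (word k))).re := by
    rw [map_add, Complex.add_re, hah, zero_add]
    exact neg_sum_norm_le_re_map_sum w (ω.expect Λ') a (fun k => ladderWord (word k))
      fun k _ => ω.neg_norm_le_re_mul_expect_ladderWord Λ' (a k) (word k)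
  have hcert' : (Xw - ∑ σ : Fin 2, ((μ σ : ℝ) : ℂ) • (nAt 0 hz σ - ((ν : ℝ) : ℂ) • (1 : FermionOp Λ')) -
        ((κ : ℝ) : ℂ) • (((u : ℝ) : ℂ) • (1 : FermionOp Λ') -
          fermionEmbed (PolySite.incl h0) ((hubbardTTPrimeFermionInteraction t t' U).meanEnergyObs 1))) -
        (c : ℂ) • (1 : FermionOp Λ') =
      gramForm Λm O +
        (∑ k ∈ s, ((hubbardTTPrimeFermionInteraction t t' U).localHamiltonian Λ' * fermionEmbed (PolySite.incl hΛ) (B k) -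
            fermionEmbed (PolySite.incl hΛ) (B k) * (hubbardTTPrimeFermionInteraction t t' U).localHamiltonian Λ') +
          ∑ l ∈ tt, (fermionEmbed (PolySite.incl (hsh l)) (fermionEmbed (PolySite.d4Emb (γ l) (wv l) Λ) (Y l)) -
            fermionEmbed (PolySite.incl hΛ) (Y l)) +
          ∑ j ∈ uu, b j • ladderWord (cw j)) +
        (∑ r ∈ rr, ((lam r : ℝ) : ℂ) •
            (((β : ℝ) : ℂ) • ((fermionEmbed (PolySite.incl hΛ) (A r))ᴴ *
                ((hubbardTTPrimeFermionInteraction t t' U).localHamiltonian Λ' * fermionEmbed (PolySite.incl hΛ) (A r) -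
                  fermionEmbed (PolySite.incl hΛ) (A r) * (hubbardTTPrimeFermionInteraction t t' U).localHamiltonian Λ')) -
              ((sv r : ℝ) : ℂ) • ((fermionEmbed (PolySite.incl hΛ) (A r))ᴴ * fermionEmbed (PolySite.incl hΛ) (A r)) +
              ((qv r : ℝ) : ℂ) • (fermionEmbed (PolySite.incl hΛ) (A r) * (fermionEmbed (PolySite.incl hΛ) (A r))ᴴ)) +
          ∑ e ∈ gg, ((kap e : ℝ) : ℂ) • G e) +
        (∑ m' ∈ ah, ((dc m' : ℝ) : ℂ) • ((V m')ᴴ - V m') + ∑ k ∈ w, a k • ladderWord (word k)) := by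
    rw [← hcert]
    abel
  have hmain := le_re_map_of_certificate_rows (ω.expect Λ') hpos (ω.expect_one Λ') hΛm O hn hg hr hcert'
  -- read the left-hand side
  have hlhs : (ω.expect Λ' (Xw -
        ∑ σ : Fin 2, ((μ σ : ℝ) : ℂ) • (nAt 0 hz σ - ((ν : ℝ) : ℂ) • (1 : FermionOp Λ')) -
        ((κ : ℝ) : ℂ) • (((u : ℝ) : ℂ) • (1 : FermionOp Λ') -
          fermionEmbed (PolySite.incl h0) ((hubbardTTPrimeFermionInteraction t t' U).meanEnergyObs 1)))).re =
      (ω.expect Λ' Xw).re - ∑ σ : Fin 2, μ σ * ((ω.expect Λ' (nAt 0 hz σ)).re - ν) -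
        κ * (u - ω.meanEnergy (hubbardTTPrimeFermionInteraction t t' U) 1) := by
    rw [map_sub, map_sub, Complex.sub_re, Complex.sub_re, map_sum, Complex.re_sum, map_smul, smul_eq_mul,
      Complex.re_ofReal_mul, map_sub, map_smul, ω.expect_one, Complex.sub_re, smul_eq_mul, mul_one,
      Complex.ofReal_re, ω.compatible h0, InfVolFermionState.meanEnergy]
    congr 2
    refine Finset.sum_congr rfl fun σ _ => ?_
    rw [map_smul, smul_eq_mul, Complex.re_ofReal_mul, map_sub, map_smul, ω.expect_one, Complex.sub_re,
      smul_eq_mul, mul_one, Complex.ofReal_re]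
  rw [hlhs] at hmain
  linarith

/-! ### §3 The thermal certificate bounds every thermal torus-limit state -/

/-- **The `t–t'` thermal window certificate bounds every torus limit of canonical Gibbs states.**
Let `ω` be a torus limit of the canonical Gibbs states of `hubbardTorusTT' (Ls j) t t' U` at inverse
temperature `β` on the sectors `(rectN n (Ls j), S^z = 0)` along `Ls → ∞`
(`IsTorusLimitOfMixture` with the data of `TorusSectorGibbsMixture`; any `β, t, t', U, n`). Then every
TRANSLATION-reduced thermal certificate (the identity of `re_expect_ge_of_thermal_certificate_TT'_of_rows`
with all `γₗ = 1` and `thicken Λ 1 ⊆ Λ'`) whose energy–entropy-balance generators `Aᵣ` conserve the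
local particle number and `S^z`, with slopes `e^{sᵣ−1} ≤ qᵣ` and multipliers `λᵣ ≥ 0`, proves
`c − Σₖ ‖aₖ‖ + Σ_σ μ_σ (Re ω_{Λ'}(n_{0σ}) − ν) + κ (u − e^{tt'}(ω)) ≤ Re ω_{Λ'}(Xw)`:
the eom rows hold by stationarity of thermal torus limits
(`expect_commutator_localHamiltonian_eq_zero_of_sectorGibbs`), the translation defects by translation
invariance (`IsTorusLimitOfMixture.isTranslationInvariant`), the charged words (nonzero particle
or spin charge) by gauge invariance of sector states (`expect_ladderWord_eq_zero_of_sectorGibbs`), and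
the EEB rows by `re_expect_eeb_nonneg_of_sectorGibbs_of_thicken_subset`; only the extra rows `Gₑ`
(e.g. the cut/cap energy rows of `TorusSectorGibbsMixture`) remain hypotheses, and the density terms
are evaluated by `re_expect_nAt_eq_of_sectorGibbs` (`Re ω_{Λ'}(n_{0σ}) = n/2`).
Fawzi–Fawzi–Scalet 2024 Thm. 3.6 (the EEB-constrained relaxation brackets `ω(O)` for every
translation-invariant KMS state), here for the torus-limit thermal states of the `t–t'–U` Hubbard
model. [cite: FawziFawziScalet2024, Thm. 3.6] -/
theorem IsTorusLimitOfMixture.re_expect_ge_of_thermal_certificate_TT'_of_sectorGibbs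
    (t t' U : ℝ) {n : ℝ} (β : ℝ) {ω : InfVolFermionState 2} {Ls : ℕ → ℕ}
    (h : ω.IsTorusLimitOfMixture (sectorGibbsCount n) (fun L => sectorGibbsWeightTT' β t t' U n L)
      (fun L => sectorGibbsVectorTT' t t' U n L) Ls)
    (hLs : Tendsto Ls atTop atTop)
    {Λ Λ' : Finset (Site 2)} (hΛ : Λ ⊆ Λ') (h8 : thicken Λ 1 ⊆ Λ')
    (h0 : thicken ({0} : Finset (Site 2)) 1 ⊆ Λ') (hz : (0 : Site 2) ∈ Λ')
    (Xw : FermionOp Λ') (κ u : ℝ) (μ : Fin 2 → ℝ) (ν : ℝ)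
    {m : Type*} [Fintype m] [DecidableEq m] {Λm : Matrix m m ℂ} (hΛm : Λm.PosSemidef)
    (O : m → FermionOp Λ')
    {κ' : Type*} (s : Finset κ') (B : κ' → FermionOp Λ)
    {ι : Type*} (tt : Finset ι) (γ : ι → DihedralGroup 4) (hγ : ∀ l ∈ tt, γ l = 1) (wv : ι → Site 2)
    (hsh : ∀ l, d4ShiftSet (γ l) (wv l) Λ ⊆ Λ') (Y : ι → FermionOp Λ)
    {ρ : Type*} (uu : Finset ρ) (b : ρ → ℂ) (cw : ρ → List (Orb (PolySite Λ') × Bool))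
    (hcw : ∀ j ∈ uu, ladderCharge (cw j) ≠ 0 ∨ ladderSpinCharge (cw j) ≠ 0)
    {θ : Type*} (rr : Finset θ) (lam : θ → ℝ) (hlam : ∀ r ∈ rr, 0 ≤ lam r) (A : θ → FermionOp Λ)
    (hAN : ∀ r ∈ rr, Commute (A r) (totalNumber : FermionOp Λ))
    (hAS : ∀ r ∈ rr, Commute (A r) (HubbardWave0.spinZ : FermionOp Λ))
    (sv qv : θ → ℝ) (hq : ∀ r ∈ rr, Real.exp (sv r - 1) ≤ qv r)
    {η : Type*} (gg : Finset η) (kap : η → ℝ) (hkap : ∀ e ∈ gg, 0 ≤ kap e) (G : η → FermionOp Λ')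
    (hG : ∀ e ∈ gg, 0 ≤ (ω.expect Λ' (G e)).re)
    {δ : Type*} (ah : Finset δ) (dc : δ → ℝ) (V : δ → FermionOp Λ')
    {κ'' : Type*} (w : Finset κ'') (a : κ'' → ℂ) (word : κ'' → List (Orb (PolySite Λ') × Bool)) {c : ℝ}
    (hcert : Xw - (c : ℂ) • (1 : FermionOp Λ') -
        ∑ σ : Fin 2, ((μ σ : ℝ) : ℂ) • (nAt 0 hz σ - ((ν : ℝ) : ℂ) • (1 : FermionOp Λ')) -
        ((κ : ℝ) : ℂ) • (((u : ℝ) : ℂ) • (1 : FermionOp Λ') -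
          fermionEmbed (PolySite.incl h0) ((hubbardTTPrimeFermionInteraction t t' U).meanEnergyObs 1)) =
      gramForm Λm O +
        (∑ k ∈ s, ((hubbardTTPrimeFermionInteraction t t' U).localHamiltonian Λ' * fermionEmbed (PolySite.incl hΛ) (B k) -
            fermionEmbed (PolySite.incl hΛ) (B k) * (hubbardTTPrimeFermionInteraction t t' U).localHamiltonian Λ') +
          ∑ l ∈ tt, (fermionEmbed (PolySite.incl (hsh l)) (fermionEmbed (PolySite.d4Emb (γ l) (wv l) Λ) (Y l)) -
            fermionEmbed (PolySite.incl hΛ) (Y l)) +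
          ∑ j ∈ uu, b j • ladderWord (cw j)) +
        (∑ r ∈ rr, ((lam r : ℝ) : ℂ) •
            (((β : ℝ) : ℂ) • ((fermionEmbed (PolySite.incl hΛ) (A r))ᴴ *
                ((hubbardTTPrimeFermionInteraction t t' U).localHamiltonian Λ' * fermionEmbed (PolySite.incl hΛ) (A r) -
                  fermionEmbed (PolySite.incl hΛ) (A r) * (hubbardTTPrimeFermionInteraction t t' U).localHamiltonian Λ')) -
              ((sv r : ℝ) : ℂ) • ((fermionEmbed (PolySite.incl hΛ) (A r))ᴴ * fermionEmbed (PolySite.incl hΛ) (A r)) +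
              ((qv r : ℝ) : ℂ) • (fermionEmbed (PolySite.incl hΛ) (A r) * (fermionEmbed (PolySite.incl hΛ) (A r))ᴴ)) +
          ∑ e ∈ gg, ((kap e : ℝ) : ℂ) • G e) +
        (∑ m' ∈ ah, ((dc m' : ℝ) : ℂ) • ((V m')ᴴ - V m') + ∑ k ∈ w, a k • ladderWord (word k))) :
    c - ∑ k ∈ w, ‖a k‖ + ∑ σ : Fin 2, μ σ * ((ω.expect Λ' (nAt 0 hz σ)).re - ν) +
        κ * (u - ω.meanEnergy (hubbardTTPrimeFermionInteraction t t' U) 1) ≤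
      (ω.expect Λ' Xw).re := by
  have hω : ω.IsTranslationInvariant := h.isTranslationInvariant
  -- charged words: gauge invariance of sector states
  have hch : ∀ j ∈ uu, ω.expect Λ' (ladderWord (cw j)) = 0 := fun j hj =>
    h.expect_ladderWord_eq_zero_of_sectorGibbs t t' U n β hLs (cw j) (hcw j hj)
  -- translation defects: `γₗ = 1`
  have hsym : ∀ l ∈ tt, ω.expect Λ'
      (fermionEmbed (PolySite.incl (hsh l)) (fermionEmbed (PolySite.d4Emb (γ l) (wv l) Λ) (Y l)) -
        fermionEmbed (PolySite.incl hΛ) (Y l)) = 0 := by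
    intro l hl
    have hsh1 : d4ShiftSet 1 (wv l) Λ ⊆ Λ' := by rw [← hγ l hl]; exact hsh l
    have h1 := hω.expect_translationDefect_eq_zero hΛ (wv l) hsh1 (Y l)
    revert h1
    have : ∀ (g : DihedralGroup 4) (hg : d4ShiftSet g (wv l) Λ ⊆ Λ'), g = 1 →
        (ω.expect Λ' (fermionEmbed (PolySite.incl hg) (fermionEmbed (PolySite.d4Emb g (wv l) Λ) (Y l)) -
          fermionEmbed (PolySite.incl hΛ) (Y l)) = 0 →
        ω.expect Λ' (fermionEmbed (PolySite.incl (hsh l)) (fermionEmbed (PolySite.d4Emb (γ l) (wv l) Λ) (Y l)) -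
          fermionEmbed (PolySite.incl hΛ) (Y l)) = 0) := by
      intro g hg hg1 h2
      subst hg1
      have hγ1 := hγ l hl
      revert hg h2
      generalize hsh l = hshl
      revert hshl
      rw [hγ1]
      intro hshl hg h2
      exact h2
    exact this 1 hsh1 rfl
  -- eom rows: stationarity of thermal torus limits
  have heom : ∀ k ∈ s, ω.expect Λ'
      ((hubbardTTPrimeFermionInteraction t t' U).localHamiltonian Λ' * fermionEmbed (PolySite.incl hΛ) (B k) -
        fermionEmbed (PolySite.incl hΛ) (B k) * (hubbardTTPrimeFermionInteraction t t' U).localHamiltonian Λ') = 0 :=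
    fun k _ => h.expect_commutator_localHamiltonian_eq_zero_of_sectorGibbs t t' U β hLs hΛ h8 (B k)
  -- energy–entropy balance rows
  have heeb : ∀ r ∈ rr, 0 ≤ (ω.expect Λ'
      (((β : ℝ) : ℂ) • ((fermionEmbed (PolySite.incl hΛ) (A r))ᴴ *
          ((hubbardTTPrimeFermionInteraction t t' U).localHamiltonian Λ' * fermionEmbed (PolySite.incl hΛ) (A r) -
            fermionEmbed (PolySite.incl hΛ) (A r) * (hubbardTTPrimeFermionInteraction t t' U).localHamiltonian Λ')) -
        ((sv r : ℝ) : ℂ) • ((fermionEmbed (PolySite.incl hΛ) (A r))ᴴ * fermionEmbed (PolySite.incl hΛ) (A r)) +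
        ((qv r : ℝ) : ℂ) • (fermionEmbed (PolySite.incl hΛ) (A r) * (fermionEmbed (PolySite.incl hΛ) (A r))ᴴ))).re :=
    fun r hr => h.re_expect_eeb_nonneg_of_sectorGibbs_of_thicken_subset t t' U β hLs hΛ h8 (hAN r hr) (hAS r hr)
      (hq r hr)
  exact ω.re_expect_ge_of_thermal_certificate_TT'_of_rows t t' U β hΛ h0 hz Xw κ u μ ν hΛm O s B tt γ wv hsh Y
    uu b cw rr lam A sv qv gg kap G ah dc V w a word hcert heom hsym hch hlam heeb hkap hG

/-! ### §4 The certified thermal energy window -/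

/-- **Certified two-sided thermal energy window.** Let `ω` be a torus limit of the canonical Gibbs
states of `hubbardTorusTT' (Ls j) t t' U` at inverse temperature `β` on the sectors
`(rectN n (Ls j), S^z = 0)` (`U ≥ 0`, `0 ≤ n < 2`, `Ls → ∞`). The LOWER edge is the variational (cut)
row `energyDensityTT' t t' U n ≤ e^{tt'}(ω)` of `TorusLimitOfMixtures`/`TorusSectorGibbsMixture`; an
UPPER edge `e^{tt'}(ω) ≤ ub` is exactly a bound `−ub ≤ Re ω_{Λ'}(−Γ E^{tt'}_Φ)` on the window
observable `Xw = −Γ E^{tt'}_Φ` — the conclusion of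
`re_expect_ge_of_thermal_certificate_TT'_of_sectorGibbs` for a thermal certificate with that objective,
`μ = 0`, `κ = 0`, and `−ub = c − Σₖ ‖aₖ‖`. Hence `e^{tt'}(ω) ∈ [energyDensityTT' t t' U n, ub]`: a
certified thermal energy window at `(t, t', U, n, T = 1/β)` in the torus-limit thermal convention.
[cite: FawziFawziScalet2024, Thm. 3.6] -/
theorem IsTorusLimitOfMixture.meanEnergy_mem_Icc_of_re_expect_ge_of_sectorGibbs
    (t t' : ℝ) {U : ℝ} (hU : 0 ≤ U) {n : ℝ} (hn0 : 0 ≤ n) (hn2 : n < 2) (β : ℝ)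
    {ω : InfVolFermionState 2} {Ls : ℕ → ℕ}
    (h : ω.IsTorusLimitOfMixture (sectorGibbsCount n) (fun L => sectorGibbsWeightTT' β t t' U n L)
      (fun L => sectorGibbsVectorTT' t t' U n L) Ls)
    (hLs : Tendsto Ls atTop atTop) {Λ' : Finset (Site 2)} (h0 : thicken ({0} : Finset (Site 2)) 1 ⊆ Λ')
    {ub : ℝ} (hub : -ub ≤ (ω.expect Λ'
      (-fermionEmbed (PolySite.incl h0) ((hubbardTTPrimeFermionInteraction t t' U).meanEnergyObs 1))).re) :
    ω.meanEnergy (hubbardTTPrimeFermionInteraction t t' U) 1 ∈ Set.Icc (energyDensityTT' t t' U n) ub := by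
  refine ⟨h.energyDensityTT'_le_meanEnergy_of_sectorGibbs t t' U hn0 hn2 β hLs t' hU, ?_⟩
  rw [map_neg, Complex.neg_re, ω.re_expect_fermionEmbed_meanEnergyObs _ 1 h0] at hub
  linarith

/-- The same window with the LOWER edge also read from a certificate: a bound
`lb ≤ Re ω_{Λ'}(Γ E^{tt'}_Φ)` (objective `Xw = +Γ E^{tt'}_Φ`) and a bound `−ub ≤ Re ω_{Λ'}(−Γ E^{tt'}_Φ)`
give `e^{tt'}(ω) ∈ [lb, ub]` for ANY infinite-volume state `ω` (no torus-limit hypothesis: this is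
bookkeeping, `Re ω_{Λ'}(Γ E^{tt'}_Φ) = e^{tt'}(ω)`). [cite: FawziFawziScalet2024, Thm. 3.6] -/
theorem meanEnergy_mem_Icc_of_re_expect_ge (ω : InfVolFermionState 2) (t t' U : ℝ)
    {Λ' : Finset (Site 2)} (h0 : thicken ({0} : Finset (Site 2)) 1 ⊆ Λ') {lb ub : ℝ}
    (hlb : lb ≤ (ω.expect Λ'
      (fermionEmbed (PolySite.incl h0) ((hubbardTTPrimeFermionInteraction t t' U).meanEnergyObs 1))).re)
    (hub : -ub ≤ (ω.expect Λ'
      (-fermionEmbed (PolySite.incl h0) ((hubbardTTPrimeFermionInteraction t t' U).meanEnergyObs 1))).re) :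
    ω.meanEnergy (hubbardTTPrimeFermionInteraction t t' U) 1 ∈ Set.Icc lb ub := by
  rw [map_neg, Complex.neg_re, ω.re_expect_fermionEmbed_meanEnergyObs _ 1 h0] at hub
  rw [ω.re_expect_fermionEmbed_meanEnergyObs _ 1 h0] at hlb
  exact ⟨hlb, by linarith⟩

end InfVolFermionState

end Literature.MathematicalPhysics.QuantumLattice

end
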